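import Summits.ResolutionOfSingularities.ResolutionOfSingularities.Theorems.PurelyInseparableDim4AtlasChildCharts
import Summits.ResolutionOfSingularities.ResolutionOfSingularities.Theorems.PurelyInseparableDim4AtlasOwnership
import Summits.ResolutionOfSingularities.ResolutionOfSingularities.Theorems.PurelyInseparableDim4JointHereditaryModel
import Summits.ResolutionOfSingularities.ResolutionOfSingularities.Theorems.PurelyInseparableDim4JointForestStep
import HarnessLib

/-!
# Purely inseparable four-folds: the OWNED PIECES and the FIBRE PIECES of an atlas child (brick S3 (c) v4, tranche 1, brick A1-pieces;
# cell `res-dim4-pi`)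

[OURS · counted 0] (D-0157 DOOR 2; host item stmt-ResolutionOfSingularities-16155, helper). Nothing here proves resolution of
singularities in dimension ≥ 4 / characteristic `p`. Steps (6)–(7) of the A1 architecture (`res-dim4-typ-3/S3c-V4-ATLAS-MEMBERS-DESIGN.md`
§10), in the setting of `…AtlasChildCharts` (p715442): translated model charts `m ∈ Pc ⊆ S` (re-centrings `Θ_m` by `b`, `b|_S = 0`) reading
a model set `Zs ⊆ Bl` as `V(z, x_{T_m})`, a ranking `rk` injective on `Pc`; the OWNED PIECE of chart `m` is `V(z, x_{T_m}) ∩ {x_{m′} = 0 :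
rk m′ < rk m}` («first chart that sees the point», A1a in `Fin 4` indexing). MODEL: the chart images of the owned pieces cover `Zs` and are
pairwise disjoint. STAGE: for the pull `c″` of `Zs` through the comparison `ε` (membership clause of `atlas_child_of_charts`) the zigzag
images `φ″_m(ψ″_m⁻¹(owned piece))` cover `c″` and are pairwise disjoint. FIBRE PIECES: for every `m` and values `v` the zigzag image of
`V(z, x_{T_m}) ∩ {x_i = v_i : i ∈ Pc ∖ {m}}` (the base times ONE point of the bundle fibre) is CLOSED in `W` — 61a's
`isClosed_image_waitingSetZ_chart` on the model (`S ∖ {m} ⊆ T_m ∪ (Pc ∖ {m})`) transported by `zigzag_transport_isClosed` over the parent's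
closed base — the fibre-closedness clause of `MemberAtlasZF` for the child's readings.

* `chart_owned_pieces_cover`, `chart_owned_pieces_disjoint` (model), `zigzag_owned_pieces_cover`, `zigzag_owned_pieces_disjoint` (stage),
  **`isClosed_zigzag_fibre_piece`**. AI-produced formalisation, weaker than expert review.
bears_on: LADDER-RESOLUTION:D157-DOOR2 (res-dim4-pi · S3 (c) v4 A1-pieces).
-/

set_option linter.dupNamespace false -- D-0017: single-problem summit path `Summit.<S>.<S>.…` by design

noncomputable section

open MvPolynomial Finset CategoryTheory AlgebraicGeometry Opposite TopologicalSpace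
open AlgebraicGeometry.Scheme.IdealSheafData (ofIdealTop vanishingIdeal)

namespace Summit.ResolutionOfSingularities.ResolutionOfSingularities.Theorems.PIDim4

open Literature.AlgebraicGeometry.Resolution
open Literature.AlgebraicGeometry.Resolution.AffinePointBlowup (P A γ coord Wtop ξ)

namespace Equimultiple

/-! ## §1 Model: owned pieces cover and are disjoint (`Fin 4` indexing) -/

section ModelPieces

variable {K : Type} [Field K] {S : Finset (Fin 4)} {Bl : Scheme.{0}} {B : Bl ⟶ P 4 K}

/-- **OWNED PIECES COVER** (A1a `owned_pieces_cover` in the `Fin 4` indexing of the v4 readings): every point of `Zs` is owned by the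
first chart (for `rk`) that sees it. [cite: BierstoneGrigorievMilmanWlodarczyk2011, Def. 3.1.3 (4)] [cite: Hauser2010, §G] -/
theorem chart_owned_pieces_cover
    (hB : IsBlowup B (AffineCoordBlowup.𝓘Λ 4 K (insert 0 (Fin.succ '' (S : Set (Fin 4))))))
    (Pc : Finset (Fin 4)) (hP : ∀ m ∈ Pc, m ∈ S) (Θ : Fin 4 → (A 4 K ≃ₐ[K] A 4 K))
    (hΘ : ∀ m ∈ Pc, ∀ m' ∈ Pc, Θ m (X m'.succ) = X m'.succ) (Tm : Fin 4 → Finset (Fin 4)) (rk : Fin 4 → ℕ) (Zs : Set Bl)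
    (hZ : ∀ m (hm : m ∈ Pc), Zs ∩ Set.range (Spec.map (CommRingCat.ofHom (Θ m : A 4 K →+* A 4 K)) ≫
        AffineCoordBlowup.chartImm hB (ChartDictionary.succ_mem_centreVars (hP m hm))) ⊆
      (Spec.map (CommRingCat.ofHom (Θ m : A 4 K →+* A 4 K)) ≫
        AffineCoordBlowup.chartImm hB (ChartDictionary.succ_mem_centreVars (hP m hm))) ''
        (AffineCoordBlowup.CΛ 4 K (insert 0 (Fin.succ '' (Tm m : Set (Fin 4)))) : Set (P 4 K)))
    (hcov : Zs ⊆ ⋃ (m : Fin 4) (hm : m ∈ Pc), Set.range (Spec.map (CommRingCat.ofHom (Θ m : A 4 K →+* A 4 K)) ≫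
      AffineCoordBlowup.chartImm hB (ChartDictionary.succ_mem_centreVars (hP m hm)))) :
    Zs ⊆ ⋃ (m : Fin 4) (hm : m ∈ Pc), (Spec.map (CommRingCat.ofHom (Θ m : A 4 K →+* A 4 K)) ≫
        AffineCoordBlowup.chartImm hB (ChartDictionary.succ_mem_centreVars (hP m hm))) ''
      ((AffineCoordBlowup.CΛ 4 K (insert 0 (Fin.succ '' (Tm m : Set (Fin 4)))) : Set (P 4 K)) ∩
        {y : P 4 K | ∀ m' ∈ Pc, rk m' < rk m → (X m'.succ : A 4 K) ∈ y.asIdeal}) := by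
  classical
  intro w hw
  -- the charts that see `w`, and the first of them
  set Q : Finset (Fin 4) := Pc.filter fun m => ∃ hm : m ∈ Pc,
    w ∈ Set.range (Spec.map (CommRingCat.ofHom (Θ m : A 4 K →+* A 4 K)) ≫
      AffineCoordBlowup.chartImm hB (ChartDictionary.succ_mem_centreVars (hP m hm))) with hQ
  have hQne : Q.Nonempty := by
    obtain ⟨m, hm, hwm⟩ := Set.mem_iUnion₂.mp (hcov hw)
    exact ⟨m, Finset.mem_filter.mpr ⟨hm, hm, hwm⟩⟩
  obtain ⟨m, hmQ, hmin⟩ := Q.exists_min_image rk hQne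
  obtain ⟨hmP, hmP', hwm⟩ := Finset.mem_filter.mp hmQ
  obtain ⟨y, hyC, rfl⟩ := hZ m hmP' ⟨hw, hwm⟩
  refine Set.mem_iUnion₂.mpr ⟨m, hmP', y, ⟨hyC, fun m' hm' hlt => ?_⟩, rfl⟩
  -- an earlier chart `m′` does not see `w`, so `x_{m′} ∈ 𝔭_y`
  by_contra hnot
  have hne : m' ≠ m := fun h => by subst h; exact lt_irrefl _ hlt
  have hne' : m'.succ ≠ m.succ := fun h => hne (Fin.succ_inj.mp h)
  have hsee : (Spec.map (CommRingCat.ofHom (Θ m : A 4 K →+* A 4 K)) ≫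
      AffineCoordBlowup.chartImm hB (ChartDictionary.succ_mem_centreVars (hP m hmP'))) y ∈
      (AffineCoordBlowup.chartImm hB (ChartDictionary.succ_mem_centreVars (hP m' hm'))).opensRange :=
    (specMap_chartImm_apply_mem_opensRange_iff hB (ChartDictionary.succ_mem_centreVars (hP m hmP'))
      (ChartDictionary.succ_mem_centreVars (hP m' hm')) hne' (Θ m) (hΘ m hmP' m' hm') y).mpr hnot
  have hsee' : (Spec.map (CommRingCat.ofHom (Θ m : A 4 K →+* A 4 K)) ≫
      AffineCoordBlowup.chartImm hB (ChartDictionary.succ_mem_centreVars (hP m hmP'))) y ∈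
      Set.range (Spec.map (CommRingCat.ofHom (Θ m' : A 4 K →+* A 4 K)) ≫
        AffineCoordBlowup.chartImm hB (ChartDictionary.succ_mem_centreVars (hP m' hm'))) := by
    rw [ChartDictionary.range_specMap_comp_chartImm hB _ (Θ m')]
    exact hsee
  have hm'Q : m' ∈ Q := Finset.mem_filter.mpr ⟨hm', hm', hsee'⟩
  exact absurd (hmin m' hm'Q) (not_le.mpr hlt)

/-- **OWNED PIECES ARE DISJOINT** (A1a `owned_pieces_disjoint`, `Fin 4` indexing). [cite: BierstoneGrigorievMilmanWlodarczyk2011, Def. 3.1.3 (4)] -/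
theorem chart_owned_pieces_disjoint
    (hB : IsBlowup B (AffineCoordBlowup.𝓘Λ 4 K (insert 0 (Fin.succ '' (S : Set (Fin 4))))))
    (Pc : Finset (Fin 4)) (hP : ∀ m ∈ Pc, m ∈ S) (Θ : Fin 4 → (A 4 K ≃ₐ[K] A 4 K))
    (hΘ : ∀ m ∈ Pc, ∀ m' ∈ Pc, Θ m (X m'.succ) = X m'.succ) (Tm : Fin 4 → Finset (Fin 4)) (rk : Fin 4 → ℕ)
    (hrk : Set.InjOn rk Pc) {m m' : Fin 4} (hm : m ∈ Pc) (hm' : m' ∈ Pc) (hne : m ≠ m') :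
    Disjoint
      ((Spec.map (CommRingCat.ofHom (Θ m : A 4 K →+* A 4 K)) ≫
          AffineCoordBlowup.chartImm hB (ChartDictionary.succ_mem_centreVars (hP m hm))) ''
        ((AffineCoordBlowup.CΛ 4 K (insert 0 (Fin.succ '' (Tm m : Set (Fin 4)))) : Set (P 4 K)) ∩
          {y : P 4 K | ∀ m'' ∈ Pc, rk m'' < rk m → (X m''.succ : A 4 K) ∈ y.asIdeal}))
      ((Spec.map (CommRingCat.ofHom (Θ m' : A 4 K →+* A 4 K)) ≫
          AffineCoordBlowup.chartImm hB (ChartDictionary.succ_mem_centreVars (hP m' hm'))) ''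
        ((AffineCoordBlowup.CΛ 4 K (insert 0 (Fin.succ '' (Tm m' : Set (Fin 4)))) : Set (P 4 K)) ∩
          {y : P 4 K | ∀ m'' ∈ Pc, rk m'' < rk m' → (X m''.succ : A 4 K) ∈ y.asIdeal})) := by
  have hrne : rk m ≠ rk m' := fun h => hne (hrk hm hm' h)
  -- without loss of generality `rk m′ < rk m`
  wlog hlt : rk m' < rk m generalizing m m'
  · exact (this hm' hm hne.symm hrne.symm (lt_of_le_of_ne (not_lt.mp hlt) hrne)).symm
  refine Set.disjoint_left.mpr ?_
  rintro w ⟨y, ⟨-, hy⟩, rfl⟩ ⟨y', ⟨-, -⟩, hyy'⟩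
  have hne' : m'.succ ≠ m.succ := fun h => hne.symm (Fin.succ_inj.mp h)
  -- `w` is owned by `m`, so `x_{m′} ∈ 𝔭_y` and `w` is not in the chart `m′`; but it is `φ_{m′} y′`
  have hnot : (Spec.map (CommRingCat.ofHom (Θ m : A 4 K →+* A 4 K)) ≫
      AffineCoordBlowup.chartImm hB (ChartDictionary.succ_mem_centreVars (hP m hm))) y ∉
      (AffineCoordBlowup.chartImm hB (ChartDictionary.succ_mem_centreVars (hP m' hm'))).opensRange := fun h =>
    (specMap_chartImm_apply_mem_opensRange_iff hB (ChartDictionary.succ_mem_centreVars (hP m hm))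
      (ChartDictionary.succ_mem_centreVars (hP m' hm')) hne' (Θ m) (hΘ m hm m' hm') y).mp h (hy m' hm' hlt)
  refine hnot ?_
  have : (Spec.map (CommRingCat.ofHom (Θ m : A 4 K →+* A 4 K)) ≫
      AffineCoordBlowup.chartImm hB (ChartDictionary.succ_mem_centreVars (hP m hm))) y ∈
      Set.range (Spec.map (CommRingCat.ofHom (Θ m' : A 4 K →+* A 4 K)) ≫
        AffineCoordBlowup.chartImm hB (ChartDictionary.succ_mem_centreVars (hP m' hm'))) := ⟨y', hyy'⟩
  rwa [ChartDictionary.range_specMap_comp_chartImm hB _ (Θ m')] at this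

end ModelPieces

/-! ## §2 Stage: the pulled owned pieces cover the child and are disjoint; the fibre pieces are closed -/

section StagePieces

variable {K : Type} [Field K] {Z Y W Bl : Scheme.{0}} (φ : Y ⟶ Z) [IsOpenImmersion φ] (ψ : Y ⟶ P 4 K) [IsOpenImmersion ψ]
  {π : W ⟶ Z} {B : Bl ⟶ P 4 K} {S : Finset (Fin 4)}
  (ε : (π ⁻¹ᵁ φ.opensRange : Scheme.{0}) ≅ (B ⁻¹ᵁ ψ.opensRange : Scheme.{0}))

/-- **THE ZIGZAG IMAGES OF THE OWNED PIECES COVER THE CHILD**: a closed `c″ ⊆ π⁻¹(φ(Y))` whose points are tested through `ε` against a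
model set `Zs` read as `V(z, x_{T_m})` by the covering charts. [cite: BierstoneGrigorievMilmanWlodarczyk2011, Def. 3.1.3 (4)] -/
theorem zigzag_owned_pieces_cover
    (hB : IsBlowup B (AffineCoordBlowup.𝓘Λ 4 K (insert 0 (Fin.succ '' (S : Set (Fin 4))))))
    (Pc : Finset (Fin 4)) (hP : ∀ m ∈ Pc, m ∈ S) (Θ : Fin 4 → (A 4 K ≃ₐ[K] A 4 K))
    (hΘ : ∀ m ∈ Pc, ∀ m' ∈ Pc, Θ m (X m'.succ) = X m'.succ) (Tm : Fin 4 → Finset (Fin 4)) (rk : Fin 4 → ℕ) (Zs : Set Bl)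
    (hZ : ∀ m (hm : m ∈ Pc), Zs ∩ Set.range (Spec.map (CommRingCat.ofHom (Θ m : A 4 K →+* A 4 K)) ≫
        AffineCoordBlowup.chartImm hB (ChartDictionary.succ_mem_centreVars (hP m hm))) ⊆
      (Spec.map (CommRingCat.ofHom (Θ m : A 4 K →+* A 4 K)) ≫
        AffineCoordBlowup.chartImm hB (ChartDictionary.succ_mem_centreVars (hP m hm))) ''
        (AffineCoordBlowup.CΛ 4 K (insert 0 (Fin.succ '' (Tm m : Set (Fin 4)))) : Set (P 4 K)))
    (hcov : Zs ⊆ ⋃ (m : Fin 4) (hm : m ∈ Pc), Set.range (Spec.map (CommRingCat.ofHom (Θ m : A 4 K →+* A 4 K)) ≫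
      AffineCoordBlowup.chartImm hB (ChartDictionary.succ_mem_centreVars (hP m hm))))
    (c'' : Set W) (hcV : c'' ⊆ ((π ⁻¹ᵁ φ.opensRange : W.Opens) : Set W))
    (hmemε : ∀ (w : W) (hwV : w ∈ π ⁻¹ᵁ φ.opensRange), w ∈ c'' ↔ ((B ⁻¹ᵁ ψ.opensRange).ι (ε.hom ⟨w, hwV⟩) : Bl) ∈ Zs) :
    c'' ⊆ ⋃ (m : Fin 4) (hm : m ∈ Pc),
      (((Spec.map (CommRingCat.ofHom (Θ m : A 4 K →+* A 4 K)) ≫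
          AffineCoordBlowup.chartImm hB (ChartDictionary.succ_mem_centreVars (hP m hm))) ∣_ (B ⁻¹ᵁ ψ.opensRange)) ≫
        ε.inv ≫ (π ⁻¹ᵁ φ.opensRange).ι) ''
      (((Spec.map (CommRingCat.ofHom (Θ m : A 4 K →+* A 4 K)) ≫
          AffineCoordBlowup.chartImm hB (ChartDictionary.succ_mem_centreVars (hP m hm))) ⁻¹ᵁ (B ⁻¹ᵁ ψ.opensRange)).ι ⁻¹'
        ((AffineCoordBlowup.CΛ 4 K (insert 0 (Fin.succ '' (Tm m : Set (Fin 4)))) : Set (P 4 K)) ∩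
          {y : P 4 K | ∀ m' ∈ Pc, rk m' < rk m → (X m'.succ : A 4 K) ∈ y.asIdeal})) := by
  intro w hw
  have hwV : w ∈ π ⁻¹ᵁ φ.opensRange := hcV hw
  have hz := (hmemε w hwV).mp hw
  obtain ⟨m, hm, hzm⟩ := Set.mem_iUnion₂.mp (chart_owned_pieces_cover hB Pc hP Θ hΘ Tm rk Zs hZ hcov hz)
  exact Set.mem_iUnion₂.mpr ⟨m, hm, (mem_image_zigzag_chart_iff φ ψ ε _ _ hwV).mpr hzm⟩

/-- **THE ZIGZAG IMAGES OF THE OWNED PIECES ARE DISJOINT.** [cite: BierstoneGrigorievMilmanWlodarczyk2011, Def. 3.1.3 (4)] -/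
theorem zigzag_owned_pieces_disjoint
    (hB : IsBlowup B (AffineCoordBlowup.𝓘Λ 4 K (insert 0 (Fin.succ '' (S : Set (Fin 4))))))
    (Pc : Finset (Fin 4)) (hP : ∀ m ∈ Pc, m ∈ S) (Θ : Fin 4 → (A 4 K ≃ₐ[K] A 4 K))
    (hΘ : ∀ m ∈ Pc, ∀ m' ∈ Pc, Θ m (X m'.succ) = X m'.succ) (Tm : Fin 4 → Finset (Fin 4)) (rk : Fin 4 → ℕ)
    (hrk : Set.InjOn rk Pc) {m m' : Fin 4} (hm : m ∈ Pc) (hm' : m' ∈ Pc) (hne : m ≠ m') :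
    Disjoint
      ((((Spec.map (CommRingCat.ofHom (Θ m : A 4 K →+* A 4 K)) ≫
            AffineCoordBlowup.chartImm hB (ChartDictionary.succ_mem_centreVars (hP m hm))) ∣_ (B ⁻¹ᵁ ψ.opensRange)) ≫
          ε.inv ≫ (π ⁻¹ᵁ φ.opensRange).ι) ''
        (((Spec.map (CommRingCat.ofHom (Θ m : A 4 K →+* A 4 K)) ≫
            AffineCoordBlowup.chartImm hB (ChartDictionary.succ_mem_centreVars (hP m hm))) ⁻¹ᵁ (B ⁻¹ᵁ ψ.opensRange)).ι ⁻¹'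
          ((AffineCoordBlowup.CΛ 4 K (insert 0 (Fin.succ '' (Tm m : Set (Fin 4)))) : Set (P 4 K)) ∩
            {y : P 4 K | ∀ m'' ∈ Pc, rk m'' < rk m → (X m''.succ : A 4 K) ∈ y.asIdeal})))
      ((((Spec.map (CommRingCat.ofHom (Θ m' : A 4 K →+* A 4 K)) ≫
            AffineCoordBlowup.chartImm hB (ChartDictionary.succ_mem_centreVars (hP m' hm'))) ∣_ (B ⁻¹ᵁ ψ.opensRange)) ≫
          ε.inv ≫ (π ⁻¹ᵁ φ.opensRange).ι) ''
        (((Spec.map (CommRingCat.ofHom (Θ m' : A 4 K →+* A 4 K)) ≫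
            AffineCoordBlowup.chartImm hB (ChartDictionary.succ_mem_centreVars (hP m' hm'))) ⁻¹ᵁ (B ⁻¹ᵁ ψ.opensRange)).ι ⁻¹'
          ((AffineCoordBlowup.CΛ 4 K (insert 0 (Fin.succ '' (Tm m' : Set (Fin 4)))) : Set (P 4 K)) ∩
            {y : P 4 K | ∀ m'' ∈ Pc, rk m'' < rk m' → (X m''.succ : A 4 K) ∈ y.asIdeal}))) := by
  rw [zigzag_transport_image_eq_pull φ ψ ε, zigzag_transport_image_eq_pull φ ψ ε]
  exact zigzag_pull_disjoint φ ψ ε (chart_owned_pieces_disjoint hB Pc hP Θ hΘ Tm rk hrk hm hm' hne)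

/-- **THE FIBRE PIECES OF AN ATLAS CHILD ARE CLOSED.** Setting of `atlas_child_of_charts`; in addition the re-centrings are cleanings
(`Θ_m z = z + h_m(x)`), `S ∖ {m} ⊆ T_m ∪ (Pc ∖ {m})` and `(Pc ∖ {m}) ∩ T_m = ∅`. Then for every `m ∈ Pc` and `v` the zigzag image of
`V(z, x_{T_m}) ∩ {x_i = v_i : i ∈ Pc ∖ {m}}` is closed in `W`. [cite: BierstoneGrigorievMilmanWlodarczyk2011, Def. 3.1.3 (2)]
[cite: StacksProject, Tag 01J7] -/
theorem isClosed_zigzag_fibre_piece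
    (hB : IsBlowup B (AffineCoordBlowup.𝓘Λ 4 K (insert 0 (Fin.succ '' (S : Set (Fin 4))))))
    (hsq : ε.hom ≫ (B ∣_ ψ.opensRange) = (π ∣_ φ.opensRange) ≫ (φ.isoOpensRange.inv ≫ ψ.isoOpensRange.hom))
    (Pc : Finset (Fin 4)) (hPc : ∀ m ∈ Pc, m ∈ S) (Θ : Fin 4 → (A 4 K ≃ₐ[K] A 4 K)) {b : Fin 4 → K}
    (hΘ : ∀ m ∈ Pc, ∀ i : Fin 4, Θ m (X i.succ) = X i.succ + C (b i)) (hbS : ∀ i ∈ S, b i = 0)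
    (hΘ0 : ∀ m ∈ Pc, ∃ h : MvPolynomial (Fin 4) K, Θ m (X 0) = X 0 + rename Fin.succ h)
    (Tm : Fin 4 → Finset (Fin 4)) (hTm : ∀ m ∈ Pc, m ∈ Tm m) (hST : ∀ m ∈ Pc, S.erase m ⊆ Tm m ∪ Pc.erase m)
    (hPT : ∀ m ∈ Pc, ∀ i ∈ Pc, i ≠ m → i ∉ Tm m)
    (D : Finset (Fin 4)) (hD : ∀ i ∈ D, i ∉ S ∧ ∀ m ∈ Pc, i ∈ Tm m)
    (hfib : IsClosed (φ '' (ψ ⁻¹' {x : P 4 K | x ∈ (AffineCoordBlowup.CΛ 4 K (insert 0 (Fin.succ '' (S : Set (Fin 4)))) : Set (P 4 K)) ∧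
      ∀ i ∈ D, (X i.succ - C (b i) : A 4 K) ∈ x.asIdeal})))
    (Zm : Bl.IdealSheafData)
    (hZread : ∀ m (hm : m ∈ Pc), Zm.comap (Spec.map (CommRingCat.ofHom (Θ m : A 4 K →+* A 4 K)) ≫
        AffineCoordBlowup.chartImm hB (ChartDictionary.succ_mem_centreVars (hPc m hm))) =
      AffineCoordBlowup.𝓘Λ 4 K (insert 0 (Fin.succ '' (Tm m : Set (Fin 4)))))
    (hcov : (Zm.support : Set Bl) ⊆ ⋃ (m : Fin 4) (hm : m ∈ Pc),
      Set.range (Spec.map (CommRingCat.ofHom (Θ m : A 4 K →+* A 4 K)) ≫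
        AffineCoordBlowup.chartImm hB (ChartDictionary.succ_mem_centreVars (hPc m hm))))
    {m : Fin 4} (hm : m ∈ Pc) (v : Fin 4 → K) :
    IsClosed ((((Spec.map (CommRingCat.ofHom (Θ m : A 4 K →+* A 4 K)) ≫
            AffineCoordBlowup.chartImm hB (ChartDictionary.succ_mem_centreVars (hPc m hm))) ∣_ (B ⁻¹ᵁ ψ.opensRange)) ≫
          ε.inv ≫ (π ⁻¹ᵁ φ.opensRange).ι) ''
        (((Spec.map (CommRingCat.ofHom (Θ m : A 4 K →+* A 4 K)) ≫
            AffineCoordBlowup.chartImm hB (ChartDictionary.succ_mem_centreVars (hPc m hm))) ⁻¹ᵁ (B ⁻¹ᵁ ψ.opensRange)).ι ⁻¹'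
          ((AffineCoordBlowup.CΛ 4 K (insert 0 (Fin.succ '' (Tm m : Set (Fin 4)))) : Set (P 4 K)) ∩
            {y : P 4 K | ∀ i ∈ Pc.erase m, (X i.succ - C (v i) : A 4 K) ∈ y.asIdeal}))) := by
  classical
  -- the chart points of the model centre lie in `V(z, x_{T_m})`
  have hread' : ∀ m (hm : m ∈ Pc), (Zm.support : Set Bl) ∩
      Set.range (Spec.map (CommRingCat.ofHom (Θ m : A 4 K →+* A 4 K)) ≫
        AffineCoordBlowup.chartImm hB (ChartDictionary.succ_mem_centreVars (hPc m hm))) ⊆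
      (Spec.map (CommRingCat.ofHom (Θ m : A 4 K →+* A 4 K)) ≫
        AffineCoordBlowup.chartImm hB (ChartDictionary.succ_mem_centreVars (hPc m hm))) ''
        (AffineCoordBlowup.CΛ 4 K (insert 0 (Fin.succ '' (Tm m : Set (Fin 4)))) : Set (P 4 K)) := by
    rintro m hm z ⟨hz, y, rfl⟩
    refine ⟨y, ?_, rfl⟩
    have h1 : y ∈ (Zm.comap (Spec.map (CommRingCat.ofHom (Θ m : A 4 K →+* A 4 K)) ≫
        AffineCoordBlowup.chartImm hB (ChartDictionary.succ_mem_centreVars (hPc m hm)))).support := by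
      rw [Scheme.IdealSheafData.support_comap]; exact hz
    rw [hZread m hm, AffineCoordBlowup.support_𝓘Λ] at h1
    exact h1
  -- the fibre piece as a translated coordinate subspace `V(z, x_i − c_i : i ∈ T_m ∪ (Pc ∖ {m}))`
  set c : Fin 4 → K := fun i => if i ∈ Tm m then 0 else v i with hc
  have hcm : c m = 0 := by simp only [hc, if_pos (hTm m hm)]
  have hset : ((AffineCoordBlowup.CΛ 4 K (insert 0 (Fin.succ '' (Tm m : Set (Fin 4)))) : Set (P 4 K)) ∩
      {y : P 4 K | ∀ i ∈ Pc.erase m, (X i.succ - C (v i) : A 4 K) ∈ y.asIdeal}) =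
      {x : P 4 K | (X 0 : A 4 K) ∈ x.asIdeal ∧ ∀ i ∈ Tm m ∪ Pc.erase m, (X i.succ - C (c i) : A 4 K) ∈ x.asIdeal} := by
    ext y
    simp only [Set.mem_inter_iff, Set.mem_setOf_eq, SetLike.mem_coe, AffineCoordBlowup.mem_CΛ_iff', Finset.mem_union,
      Set.mem_insert_iff, Set.mem_image]
    constructor
    · rintro ⟨h1, h2⟩
      refine ⟨h1 0 (Or.inl rfl), fun i hi => ?_⟩
      rcases hi with hi | hi
      · rw [hc]; simp only [if_pos hi, C_0, sub_zero]
        exact h1 i.succ (Or.inr ⟨i, hi, rfl⟩)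
      · have hiT : i ∉ Tm m := hPT m hm i (Finset.mem_of_mem_erase hi) (Finset.ne_of_mem_erase hi)
        rw [hc]; simp only [if_neg hiT]
        exact h2 i hi
    · rintro ⟨h0, h2⟩
      refine ⟨?_, fun i hi => ?_⟩
      · rintro k (rfl | ⟨i, hi, rfl⟩)
        · exact h0
        · have := h2 i (Or.inl hi)
          rw [hc] at this; simpa only [if_pos hi, C_0, sub_zero] using this
      · have hiT : i ∉ Tm m := hPT m hm i (Finset.mem_of_mem_erase hi) (Finset.ne_of_mem_erase hi)
        have := h2 i (Or.inr hi)
        rw [hc] at this; simpa only [if_neg hiT] using this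
  -- closed on the model (61a), then transported over the parent's closed base
  obtain ⟨h, h0⟩ := hΘ0 m hm
  have hTc : IsClosed ((Spec.map (CommRingCat.ofHom (Θ m : A 4 K →+* A 4 K)) ≫
        AffineCoordBlowup.chartImm hB (ChartDictionary.succ_mem_centreVars (hPc m hm))) ''
      (((AffineCoordBlowup.CΛ 4 K (insert 0 (Fin.succ '' (Tm m : Set (Fin 4)))) : Set (P 4 K)) ∩
        {y : P 4 K | ∀ i ∈ Pc.erase m, (X i.succ - C (v i) : A 4 K) ∈ y.asIdeal}))) := by
    rw [hset]
    exact isClosed_image_waitingSetZ_chart hB (hPc m hm) (hbS m (hPc m hm)) h0 (hΘ m hm) hcm (hST m hm)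
  refine ChartDictionary.zigzag_transport_isClosed φ ψ ε _ hsq _ _ hTc hfib fun y hy => ?_
  have hz : (Spec.map (CommRingCat.ofHom (Θ m : A 4 K →+* A 4 K)) ≫
      AffineCoordBlowup.chartImm hB (ChartDictionary.succ_mem_centreVars (hPc m hm))) y ∈ (Zm.support : Set Bl) := by
    have h1 : y ∈ ((Zm.comap (Spec.map (CommRingCat.ofHom (Θ m : A 4 K →+* A 4 K)) ≫
        AffineCoordBlowup.chartImm hB (ChartDictionary.succ_mem_centreVars (hPc m hm)))).support : Set (P 4 K)) := by
      rw [hZread m hm, AffineCoordBlowup.support_𝓘Λ]; exact hy.1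
    rw [Scheme.IdealSheafData.support_comap] at h1
    exact h1
  exact apply_mem_base_of_cover_readings hB Pc hPc Θ hΘ hbS Tm hTm D hD (Zm.support : Set Bl) hcov hread' hz

end StagePieces

end Equimultiple

end Summit.ResolutionOfSingularities.ResolutionOfSingularities.Theorems.PIDim4

end
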